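import Mathlib
import Literature.Geometry.Lorentzian.BoostedKerrSchildDecay
import Literature.Geometry.Lorentzian.KerrConvergenceProofs

/-!
# Route EIHFluxBalance — `ModulatedKerrHandoff`, stub `stub_dragDefect`: sharp homogeneous decay of
# the Schwarzschild Kerr–Schild perturbation

Helper file for the crux `stmt-FinalStateConjecture-10167`
(`Summit.FinalStateConjecture.FinalStateConjecture.Theses.EIHFluxBalance.ModulatedKerrHandoff`),
line `overlap-modulation-second-iterate`, stub `stub_dragDefect`.

The drag-defect estimate is scale covariant with UNIVERSAL constants, so it needs the sharp
homogeneous form of the far-field decay of the static Schwarzschild perturbation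
`h_M = g_{M,0} − η = (2M/r) ℓ ⊗ ℓ` in Kerr–Schild Cartesian coordinates:

* `exists_norm_iteratedFDeriv_ksPert_le` — **`‖Dᵐ h_M(y)‖ ≤ Cₘ |M| / ‖y̲‖^{m+1}` for ALL `y` off the
  time axis and all real `M`**, with `Cₘ` depending on `m` only (the tree's
  `Kerr.norm_iteratedFDeriv_ksPert_le` records `C(M)/r` for `r ≥ R(M)` and
  `exists_bound_iteratedFDeriv_ksPert_zero_spin` of `…InertialRecessionKerrBounds` a uniform bound on
  `{r ≥ r₀}`; the proof here is the same scaling `h_M = εM · h₁ ∘ (ε ·)`, `ε = 1/‖y̲‖`, from the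
  unit-shell bound `exists_bound_iteratedFDeriv_boostedKsPert_one`, keeping the factor `ε^{m+1}`);
* `exists_ksPert_jets_le` — the same for the TRANSLATED hole `y ↦ h_M(y − c)`, orders `m ≤ 4` with
  one constant, and the first three jets also written with `fderiv` — the form consumed by the
  coordinate curvature calculus (`MetricCoord.*`, which is phrased with `fderiv ℝ G`,
  `fderiv ℝ (fderiv ℝ G)`; iterated `fderiv`s of order `≥ 4` of form-valued maps are avoided, their
  operator spaces being too deeply nested for instance synthesis);
* `boostedKerrBilin_one`, `contDiffAt_ksPert_sub` — the unboosted translated field IS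
  `y ↦ g_{M,a}(y − c)`, smooth off the translated axis.

Kerr–Schild 1965, §2–§3; Visser arXiv:0706.0622, (32)–(35).
-/

noncomputable section

-- `Summit.<S>.<S>.…` (single-problem summit, D-0017) trips core's duplicate-namespace linter.
set_option linter.dupNamespace false
-- nested operator spaces `E4 →L E4 →L … →L F`, as in `Literature.Geometry.Lorentzian.CoordCurvature`
set_option maxSynthPendingDepth 3

open Set Filter Function Literature.Geometry.Lorentzian
open scoped Topology ContDiff

namespace Summit.FinalStateConjecture.FinalStateConjecture.Theorems

namespace DragDefect

/-! ### The unboosted translated field -/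

/-- With the trivial boost the translated field is `y ↦ g_{M,a}(y − c)`. [cite: KerrSchild1965, §2] -/
theorem boostedKerrBilin_one (c : E4) (M a : ℝ) (y : E4) :
    boostedKerrBilin 1 c M a y = Kerr.bilin M a (y - c) := by
  ext v w
  rw [boostedKerrBilin_apply, poincareInv]
  rfl

/-- The translated Schwarzschild perturbation `y ↦ g_{M,0}(y − c) − η` is `C^∞` off the translated
time axis. [cite: KerrSchild1965, §3] -/
theorem contDiffAt_ksPert_sub (M : ℝ) (c : E4) {y : E4} (hy : 0 < E4.spatialNorm (y - c))
    {n : WithTop ℕ∞} :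
    ContDiffAt ℝ n (fun z ↦ Kerr.bilin M 0 (z - c) - Minkowski.bilin) y := by
  have hr : 0 < Kerr.radius 0 (y - c) := by rwa [Kerr.radius_zero_left]
  exact (Kerr.contDiffAt_ksPert (M := M) hr).comp y (contDiff_id.sub contDiff_const).contDiffAt

/-- The translated Schwarzschild form `y ↦ g_{M,0}(y − c)` is `C^∞` off the translated time axis.
[cite: KerrSchild1965, §3] -/
theorem contDiffAt_kerr_sub (M : ℝ) (c : E4) {y : E4} (hy : 0 < E4.spatialNorm (y - c))
    {n : WithTop ℕ∞} :
    ContDiffAt ℝ n (fun z ↦ Kerr.bilin M 0 (z - c)) y := by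
  have h := (contDiffAt_ksPert_sub M c hy (n := n)).add (contDiffAt_const (c := Minkowski.bilin))
  simp only [sub_add_cancel] at h
  exact h

/-! ### Sharp homogeneous decay of all derivatives -/

/-- Unit-shell bound: `‖Dᵐ (g_{1,0} − η)(y)‖ ≤ B` for `y⁰ = 0`, `‖y̲‖ = 1`
(`exists_bound_iteratedFDeriv_boostedKsPert_one` with the trivial boost). [cite: KerrSchild1965, §3] -/
theorem exists_bound_iteratedFDeriv_ksPert_unit (m : ℕ) :
    ∃ B : ℝ, 0 ≤ B ∧ ∀ y : E4, y 0 = 0 → E4.spatialNorm y = 1 →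
      ‖iteratedFDeriv ℝ m (fun y ↦ Kerr.bilin 1 0 y - Minkowski.bilin) y‖ ≤ B := by
  obtain ⟨B, hB⟩ := exists_bound_iteratedFDeriv_boostedKsPert_one (1 : lorentzGroup) m
  refine ⟨max B 0, le_max_right _ _, fun y hy0 hy1 ↦ ?_⟩
  have hfun : (fun y ↦ boostedKerrBilin 1 0 1 0 y - Minkowski.bilin) =
      fun y ↦ Kerr.bilin 1 0 y - Minkowski.bilin := by
    funext y; rw [boostedKerrBilin_one_zero]
  have h := hB 0 (by norm_num) y (by rw [poincareInv_zero]; exact hy0)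
    (by rw [poincareInv_zero]; exact hy1)
  rw [hfun] at h
  exact h.trans (le_max_left _ _)

/-- **Sharp homogeneous decay of the Schwarzschild Kerr–Schild perturbation**: for every order `m`
there is `C ≥ 0` with `‖Dᵐ (g_{M,0} − η)(y)‖ ≤ C |M| / ‖y̲‖^{m+1}` for all real `M` and all `y` off
the time axis. Scaling: `g_{M,0} − η = εM · (g_{1,0} − η) ∘ (ε ·)` with `ε = 1/‖y̲‖`
(`Kerr.ksPert_smul`), stationarity to kill `y⁰` (`Kerr.ksPert_eq_of_spatial_eq`), and the unit-shell
bound. [cite: KerrSchild1965, §3] -/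
theorem exists_norm_iteratedFDeriv_ksPert_le (m : ℕ) :
    ∃ C : ℝ, 0 ≤ C ∧ ∀ (M : ℝ) (y : E4), 0 < E4.spatialNorm y →
      ‖iteratedFDeriv ℝ m (fun y ↦ Kerr.bilin M 0 y - Minkowski.bilin) y‖ ≤
        C * |M| / E4.spatialNorm y ^ (m + 1) := by
  obtain ⟨B, hB0, hB⟩ := exists_bound_iteratedFDeriv_ksPert_unit m
  refine ⟨B, hB0, fun M y hy ↦ ?_⟩
  set s := E4.spatialNorm y with hs
  have hs0 : 0 < s := hy
  set ε := s⁻¹ with hε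
  have hε0 : 0 < ε := inv_pos.mpr hs0
  -- kill the time coordinate by a translation along `e₀`
  set y' : E4 := y + (-(y 0)) • E4.basisVector 0 with hy'
  have h0sp : E4.spatial (E4.basisVector 0) = 0 := by
    ext i
    simp [E4.spatial_apply, Fin.succ_ne_zero]
  have hsp : E4.spatial y' = E4.spatial y := by
    rw [hy', map_add, map_smul, h0sp, smul_zero, add_zero]
  have hy'0 : y' 0 = 0 := by simp [hy']
  have hsy' : E4.spatialNorm y' = s := by rw [hs, E4.spatialNorm, E4.spatialNorm, hsp]
  have hder : iteratedFDeriv ℝ m (fun y ↦ Kerr.bilin M 0 y - Minkowski.bilin) y =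
      iteratedFDeriv ℝ m (fun y ↦ Kerr.bilin M 0 y - Minkowski.bilin) y' := by
    have hfun : (fun z ↦ Kerr.bilin M 0 (z + (-(y 0)) • E4.basisVector 0) - Minkowski.bilin) =
        fun z ↦ Kerr.bilin M 0 z - Minkowski.bilin := by
      funext z
      refine Kerr.ksPert_eq_of_spatial_eq M 0 ?_
      rw [map_add, map_smul, h0sp, smul_zero, add_zero]
    have key := iteratedFDeriv_comp_add_right (𝕜 := ℝ)
      (f := fun z ↦ Kerr.bilin M 0 z - Minkowski.bilin) m ((-(y 0)) • E4.basisVector 0) y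
    rw [hfun] at key
    rw [key]
  -- the rescaled point on the unit shell
  set y₁ : E4 := ε • y' with hy₁
  have hy₁0 : y₁ 0 = 0 := by simp [hy₁, hy'0]
  have hy₁1 : E4.spatialNorm y₁ = 1 := by
    rw [hy₁, Kerr.spatialNorm_smul, abs_of_pos hε0, hsy', hε, inv_mul_cancel₀ hs0.ne']
  have hrad₁ : 0 < Kerr.radius 0 y₁ := by
    rw [Kerr.radius_zero_left, hy₁1]; exact one_pos
  have hG : ContDiffAt ℝ m (fun w ↦ Kerr.bilin 1 0 w - Minkowski.bilin) (ε • y') :=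
    Kerr.contDiffAt_ksPert hrad₁
  have hfun : (fun y ↦ Kerr.bilin M 0 y - Minkowski.bilin) =
      fun y ↦ (ε * M) • (fun w ↦ Kerr.bilin 1 0 w - Minkowski.bilin) (ε • y) := by
    funext z
    have := Kerr.ksPert_smul hε0 M 0 z
    rw [mul_zero] at this
    rw [this]
  have hkey := norm_iteratedFDeriv_const_smul_comp_smul_le
    (fun w ↦ Kerr.bilin 1 0 w - Minkowski.bilin) (ε * M) hε0.ne' y' (m := m) hG
  have hpow : ε * ε ^ m = (s ^ (m + 1))⁻¹ := by
    rw [hε, ← pow_succ', inv_pow]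
  calc ‖iteratedFDeriv ℝ m (fun y ↦ Kerr.bilin M 0 y - Minkowski.bilin) y‖
      = ‖iteratedFDeriv ℝ m (fun y ↦ Kerr.bilin M 0 y - Minkowski.bilin) y'‖ := by rw [hder]
    _ = ‖iteratedFDeriv ℝ m (fun y ↦ (ε * M) •
          (fun w ↦ Kerr.bilin 1 0 w - Minkowski.bilin) (ε • y)) y'‖ := by rw [← hfun]
    _ ≤ |ε * M| * |ε| ^ m *
          ‖iteratedFDeriv ℝ m (fun w ↦ Kerr.bilin 1 0 w - Minkowski.bilin) (ε • y')‖ := hkey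
    _ ≤ |ε * M| * |ε| ^ m * B := by
        gcongr
        exact hB y₁ hy₁0 hy₁1
    _ = B * |M| * (ε * ε ^ m) := by rw [abs_mul, abs_of_pos hε0]; ring
    _ = B * |M| / s ^ (m + 1) := by rw [hpow, div_eq_mul_inv]

/-! ### `fderiv` forms of the first five jets, translated -/

section Jets

variable {F : Type*} [NormedAddCommGroup F] [NormedSpace ℝ F]

/-- `‖Df(y)‖ = ‖D¹f(y)‖`. [folklore] -/
theorem norm_fderiv_eq (f : E4 → F) (y : E4) : ‖fderiv ℝ f y‖ = ‖iteratedFDeriv ℝ 1 f y‖ := by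
  rw [norm_iteratedFDeriv_one]

/-- `‖D(Df)(y)‖ = ‖D²f(y)‖`. [folklore] -/
theorem norm_fderiv_fderiv_eq (f : E4 → F) (y : E4) :
    ‖fderiv ℝ (fderiv ℝ f) y‖ = ‖iteratedFDeriv ℝ 2 f y‖ := by
  rw [← norm_iteratedFDeriv_zero (𝕜 := ℝ) (f := fderiv ℝ (fderiv ℝ f)), norm_iteratedFDeriv_fderiv,
    norm_iteratedFDeriv_fderiv]

end Jets

/-- Translation: `Dᵐ[y ↦ h_M(y − c)](y) = Dᵐ h_M (y − c)`. [folklore] -/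
theorem iteratedFDeriv_ksPert_sub (M : ℝ) (c : E4) (m : ℕ) (y : E4) :
    iteratedFDeriv ℝ m (fun z ↦ Kerr.bilin M 0 (z - c) - Minkowski.bilin) y =
      iteratedFDeriv ℝ m (fun z ↦ Kerr.bilin M 0 z - Minkowski.bilin) (y - c) :=
  iteratedFDeriv_comp_sub (f := fun z ↦ Kerr.bilin M 0 z - Minkowski.bilin) m c y

/-- **The first three jets of a translated Schwarzschild hole, sharply**: one constant `C ≥ 0` such
that for all real `M`, every centre `c` and every `y` with `ρ = ‖(y − c)̲‖ > 0`, writing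
`h(z) = g_{M,0}(z − c) − η`: `‖h(y)‖ ≤ C|M|/ρ`, `‖Dh(y)‖ ≤ C|M|/ρ²`, `‖D(Dh)(y)‖ ≤ C|M|/ρ³`
(the `fderiv` forms consumed by `MetricCoord.*`), and `‖Dᵐh(y)‖ ≤ C|M|/ρ^{m+1}` for `m ≤ 4`
(`iteratedFDeriv`). [cite: KerrSchild1965, §3] -/
theorem exists_ksPert_jets_le :
    ∃ C : ℝ, 0 ≤ C ∧ ∀ (M : ℝ) (c y : E4), 0 < E4.spatialNorm (y - c) →
      ‖Kerr.bilin M 0 (y - c) - Minkowski.bilin‖ ≤ C * |M| / E4.spatialNorm (y - c) ∧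
      ‖fderiv ℝ (fun z ↦ Kerr.bilin M 0 (z - c) - Minkowski.bilin) y‖ ≤
        C * |M| / E4.spatialNorm (y - c) ^ 2 ∧
      ‖fderiv ℝ (fderiv ℝ (fun z ↦ Kerr.bilin M 0 (z - c) - Minkowski.bilin)) y‖ ≤
        C * |M| / E4.spatialNorm (y - c) ^ 3 ∧
      ∀ m ≤ 4, ‖iteratedFDeriv ℝ m (fun z ↦ Kerr.bilin M 0 (z - c) - Minkowski.bilin) y‖ ≤
        C * |M| / E4.spatialNorm (y - c) ^ (m + 1) := by
  obtain ⟨C₀, hC₀, h₀⟩ := exists_norm_iteratedFDeriv_ksPert_le 0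
  obtain ⟨C₁, hC₁, h₁⟩ := exists_norm_iteratedFDeriv_ksPert_le 1
  obtain ⟨C₂, hC₂, h₂⟩ := exists_norm_iteratedFDeriv_ksPert_le 2
  obtain ⟨C₃, hC₃, h₃⟩ := exists_norm_iteratedFDeriv_ksPert_le 3
  obtain ⟨C₄, hC₄, h₄⟩ := exists_norm_iteratedFDeriv_ksPert_le 4
  set C := C₀ + C₁ + C₂ + C₃ + C₄ with hC
  have e0 : C₀ ≤ C := by rw [hC]; linarith
  have e1 : C₁ ≤ C := by rw [hC]; linarith
  have e2 : C₂ ≤ C := by rw [hC]; linarith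
  have e3 : C₃ ≤ C := by rw [hC]; linarith
  have e4 : C₄ ≤ C := by rw [hC]; linarith
  refine ⟨C, by positivity, fun M c y hy ↦ ?_⟩
  set ρ := E4.spatialNorm (y - c) with hρ
  have hM : 0 ≤ |M| := abs_nonneg M
  have mono : ∀ {Cj : ℝ} (k : ℕ), Cj ≤ C → Cj * |M| / ρ ^ k ≤ C * |M| / ρ ^ k := fun k hj ↦ by
    gcongr
  have hflat : ∀ m ≤ 4, ‖iteratedFDeriv ℝ m (fun z ↦ Kerr.bilin M 0 (z - c) - Minkowski.bilin) y‖ ≤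
      C * |M| / ρ ^ (m + 1) := by
    intro m hm
    rw [iteratedFDeriv_ksPert_sub]
    interval_cases m
    · exact (h₀ M (y - c) hy).trans (mono 1 e0)
    · exact (h₁ M (y - c) hy).trans (mono 2 e1)
    · exact (h₂ M (y - c) hy).trans (mono 3 e2)
    · exact (h₃ M (y - c) hy).trans (mono 4 e3)
    · exact (h₄ M (y - c) hy).trans (mono 5 e4)
  refine ⟨?_, ?_, ?_, hflat⟩
  · have h := hflat 0 (by norm_num)
    rw [norm_iteratedFDeriv_zero, zero_add, pow_one] at h
    exact h
  · rw [norm_fderiv_eq]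
    exact hflat 1 (by norm_num)
  · rw [norm_fderiv_fderiv_eq]
    exact hflat 2 (by norm_num)

/-- **Registered sub-goal form** (stub `dragDefect_ksPert_sharp_decay` of the crux item) of
`exists_norm_iteratedFDeriv_ksPert_le`. [cite: KerrSchild1965, §3] -/
theorem dragDefect_ksPert_sharp_decay : open Literature.Geometry.Lorentzian in ∀ m : ℕ, ∃ C : ℝ, 0 ≤ C ∧ ∀ (M : ℝ) (y : E4), 0 < E4.spatialNorm y → ‖iteratedFDeriv ℝ m (fun y ↦ Kerr.bilin M 0 y - Minkowski.bilin) y‖ ≤ C * |M| / E4.spatialNorm y ^ (m + 1) :=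
  fun m ↦ exists_norm_iteratedFDeriv_ksPert_le m

end DragDefect

end Summit.FinalStateConjecture.FinalStateConjecture.Theorems

end
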